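import Mathlib

/-! # Stub `stub_echelonPivots` — crux `TwoProducts` (stmt-ValiantsHypothesis-5906), line `corner-log-linearization`

Framework VII, linear-algebra piece: an ECHELON basis of the tail space with pairwise distinct pivots.

Given finitely many polynomials `g i` (`i : Fin N`) and an integer weight `ω` that is injective on the
letter set `U = ⋃ supp (g i)`, Gaussian elimination along `ω` produces `r ≤ N` generators `F ρ` of the
`ℂ`-span of the `g i`, all supported in `U`, each with a STRICT `ω`-minimal support point `p ρ` (its
pivot), the pivots being pairwise distinct.  Proof: induction on `N`; a new generator `G` is reduced
against the current echelon family by repeatedly cancelling its `ω`-minimal coefficient whenever that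
minimum is an existing pivot — each cancellation strictly raises the `ω`-minimum of the support inside
the finite set `U`, so the process stops at `0` (drop `G`) or at a polynomial whose strict `ω`-minimum
is a new pivot (adjoin it). [folklore] -/

set_option linter.dupNamespace false

namespace Summit.ValiantsHypothesis.ValiantsHypothesis.Theorems.TwoProducts.EchelonPivots

open scoped BigOperators
open MvPolynomial

variable {σ K : Type*} [Field K]

/-- Reduction of one polynomial against an echelon family.  Let `ω` be injective on the finite letter
set `U`, and let `F ρ` (`ρ : Fin r`) be polynomials supported in `U` with strict `ω`-minimal support
points `p ρ`.  Then every `G` supported in `U` whose potential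
`#{u ∈ U | ∃ m ∈ supp G, ω m ≤ ω u}` is at most `n` differs from some `G'` by an element of the span of
the `F ρ`, where `G'` is supported in `U` and either vanishes or has a strict `ω`-minimal support point
that is none of the pivots `p ρ`.  (Induction on `n`: cancelling the minimal coefficient against the
matching `F ρ` lowers the potential.) [folklore] -/
theorem exists_reduce (U : Finset (σ →₀ ℕ)) (ω : (σ →₀ ℕ) → ℤ)
    (hω : ∀ q ∈ U, ∀ q' ∈ U, ω q = ω q' → q = q') {r : ℕ} (F : Fin r → MvPolynomial σ K)
    (p : Fin r → (σ →₀ ℕ)) (hFU : ∀ ρ, (F ρ).support ⊆ U)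
    (hp : ∀ ρ, p ρ ∈ (F ρ).support ∧ ∀ q ∈ (F ρ).support, q ≠ p ρ → ω (p ρ) < ω q) :
    ∀ (n : ℕ) (G : MvPolynomial σ K), G.support ⊆ U →
      (U.filter fun u => ∃ m ∈ G.support, ω m ≤ ω u).card ≤ n →
      ∃ G' : MvPolynomial σ K, G - G' ∈ Submodule.span K (Set.range F) ∧ G'.support ⊆ U ∧
        (G' = 0 ∨ ∃ q ∈ G'.support, (∀ q' ∈ G'.support, q' ≠ q → ω q < ω q') ∧ q ∉ Set.range p) := by
  classical
  intro n
  induction n with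
  | zero =>
    intro G hGU hcard
    refine ⟨G, by rw [sub_self]; exact Submodule.zero_mem _, hGU, Or.inl ?_⟩
    by_contra hG
    obtain ⟨m, hm⟩ := MvPolynomial.support_nonempty.2 hG
    have hmem : m ∈ U.filter fun u => ∃ m' ∈ G.support, ω m' ≤ ω u :=
      Finset.mem_filter.2 ⟨hGU hm, m, hm, le_rfl⟩
    exact absurd (Finset.card_pos.2 ⟨m, hmem⟩) (by omega)
  | succ n ih =>
    intro G hGU hcard
    by_cases hG : G = 0
    · exact ⟨G, by rw [sub_self]; exact Submodule.zero_mem _, hGU, Or.inl hG⟩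
    -- the strict `ω`-minimum `m₀` of the support of `G`
    obtain ⟨m₀, hm₀, hmin⟩ := G.support.exists_min_image ω (MvPolynomial.support_nonempty.2 hG)
    have hstrict : ∀ q' ∈ G.support, q' ≠ m₀ → ω m₀ < ω q' := fun q' hq' hne =>
      lt_of_le_of_ne (hmin q' hq') fun h => hne (hω q' (hGU hq') m₀ (hGU hm₀) h.symm)
    by_cases hrange : m₀ ∈ Set.range p
    swap
    · exact ⟨G, by rw [sub_self]; exact Submodule.zero_mem _, hGU, Or.inr ⟨m₀, hm₀, hstrict, hrange⟩⟩
    obtain ⟨ρ, hρ⟩ := hrange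
    -- cancel the coefficient of `m₀ = p ρ` against `F ρ`
    set c : K := G.coeff m₀ / (F ρ).coeff m₀ with hc
    set G₁ : MvPolynomial σ K := G - c • F ρ with hG₁
    have hcoeffF : (F ρ).coeff m₀ ≠ 0 := by
      rw [← hρ]
      exact MvPolynomial.mem_support_iff.1 (hp ρ).1
    have hm₀G₁ : m₀ ∉ G₁.support := by
      rw [MvPolynomial.notMem_support_iff, hG₁, MvPolynomial.coeff_sub, MvPolynomial.coeff_smul, hc,
        smul_eq_mul, div_mul_cancel₀ _ hcoeffF, sub_self]
    have hsuppG₁ : G₁.support ⊆ G.support ∪ (F ρ).support :=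
      (MvPolynomial.support_sub _ _ _).trans
        (Finset.union_subset_union le_rfl MvPolynomial.support_smul)
    have hG₁U : G₁.support ⊆ U := hsuppG₁.trans (Finset.union_subset hGU (hFU ρ))
    have hlt : ∀ m ∈ G₁.support, ω m₀ < ω m := by
      intro m hm
      have hne : m ≠ m₀ := fun h => hm₀G₁ (h ▸ hm)
      rcases Finset.mem_union.1 (hsuppG₁ hm) with h | h
      · exact hstrict m h hne
      · rw [← hρ] at hne ⊢
        exact (hp ρ).2 m h hne
    -- the potential drops strictly: `m₀` is no longer counted
    have hcard₁ : (U.filter fun u => ∃ m ∈ G₁.support, ω m ≤ ω u).card <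
        (U.filter fun u => ∃ m ∈ G.support, ω m ≤ ω u).card := by
      apply Finset.card_lt_card
      refine (Finset.ssubset_iff_of_subset ?_).2 ⟨m₀, ?_, ?_⟩
      · intro u hu
        rw [Finset.mem_filter] at hu ⊢
        obtain ⟨huU, m, hm, hmu⟩ := hu
        exact ⟨huU, m₀, hm₀, (hlt m hm).le.trans hmu⟩
      · exact Finset.mem_filter.2 ⟨hGU hm₀, m₀, hm₀, le_rfl⟩
      · rw [Finset.mem_filter, not_and]
        rintro - ⟨m, hm, hmle⟩
        exact absurd hmle (not_le.2 (hlt m hm))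
    obtain ⟨G', hG'span, hG'U, hG'⟩ := ih G₁ hG₁U (by omega)
    refine ⟨G', ?_, hG'U, hG'⟩
    have hsplit : G - G' = (G₁ - G') + c • F ρ := by
      rw [hG₁]
      abel
    rw [hsplit]
    exact Submodule.add_mem _ hG'span (Submodule.smul_mem _ _ (Submodule.subset_span ⟨ρ, rfl⟩))

/-- Echelon family (span form).  Let `ω` be injective on the finite letter set `U` and let `g i`
(`i : Fin N`) be polynomials supported in `U`.  Then there are `r ≤ N` polynomials `F ρ` supported in
`U`, spanning a space containing every `g i`, with strict `ω`-minimal support points `p ρ` that are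
pairwise distinct.  (Induction on `N`, reducing each new generator by `exists_reduce`.) [folklore] -/
theorem exists_echelon (U : Finset (σ →₀ ℕ)) (ω : (σ →₀ ℕ) → ℤ)
    (hω : ∀ q ∈ U, ∀ q' ∈ U, ω q = ω q' → q = q') :
    ∀ (N : ℕ) (g : Fin N → MvPolynomial σ K), (∀ i, (g i).support ⊆ U) →
      ∃ (r : ℕ) (F : Fin r → MvPolynomial σ K) (p : Fin r → (σ →₀ ℕ)),
        r ≤ N ∧ (∀ i, g i ∈ Submodule.span K (Set.range F)) ∧ (∀ ρ, (F ρ).support ⊆ U) ∧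
        (∀ ρ, p ρ ∈ (F ρ).support ∧ ∀ q ∈ (F ρ).support, q ≠ p ρ → ω (p ρ) < ω q) ∧
        Function.Injective p := by
  classical
  intro N
  induction N with
  | zero =>
    intro g _
    exact ⟨0, Fin.elim0, Fin.elim0, le_rfl, fun i => Fin.elim0 i, fun ρ => Fin.elim0 ρ,
      fun ρ => Fin.elim0 ρ, Function.injective_of_subsingleton _⟩
  | succ N ih =>
    intro g hgU
    obtain ⟨r, F, p, hrN, hspan, hFU, hp, hinj⟩ := ih (fun i => g i.succ) fun i => hgU i.succ
    obtain ⟨G', hG'span, hG'U, hG'⟩ := exists_reduce U ω hω F p hFU hp _ (g 0) (hgU 0) le_rfl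
    rcases hG' with hG'0 | ⟨q, hq, hqmin, hqp⟩
    · -- `g 0` already lies in the span: keep the family
      refine ⟨r, F, p, hrN.trans N.le_succ, Fin.forall_fin_succ.2 ⟨?_, hspan⟩, hFU, hp, hinj⟩
      rw [hG'0, sub_zero] at hG'span
      exact hG'span
    · -- adjoin the reduced generator `G'` with the new pivot `q`
      have hle : Submodule.span K (Set.range F) ≤
          Submodule.span K (Set.range (Fin.cons G' F : Fin (r + 1) → MvPolynomial σ K)) := by
        rw [Fin.range_cons]
        exact Submodule.span_mono (Set.subset_insert _ _)
      refine ⟨r + 1, Fin.cons G' F, Fin.cons q p, Nat.succ_le_succ hrN,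
        Fin.forall_fin_succ.2 ⟨?_, fun i => hle (hspan i)⟩, Fin.forall_fin_succ.2 ⟨?_, fun i => ?_⟩,
        Fin.forall_fin_succ.2 ⟨?_, fun i => ?_⟩, Fin.cons_injective_iff.2 ⟨hqp, hinj⟩⟩
      · have hG'mem : G' ∈
            Submodule.span K (Set.range (Fin.cons G' F : Fin (r + 1) → MvPolynomial σ K)) :=
          Submodule.subset_span ⟨0, rfl⟩
        have hsum := Submodule.add_mem _ (hle hG'span) hG'mem
        rwa [sub_add_cancel] at hsum
      · simpa only [Fin.cons_zero] using hG'U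
      · simpa only [Fin.cons_succ] using hFU i
      · simp only [Fin.cons_zero]
        exact ⟨hq, hqmin⟩
      · simp only [Fin.cons_succ]
        exact hp i

/-- Stub `stub_echelonPivots` (Framework VII of line `corner-log-linearization`): for polynomials
`g i` (`i : Fin N`) and an integer weight `ω` injective on the letter set `U = ⋃ supp (g i)`, there is
an echelon family of `r ≤ N` polynomials `F ρ` supported in `U`, with coordinates `a i ρ` writing each
`g i = ∑ ρ, a i ρ • F ρ`, strict `ω`-minimal support points `p ρ ∈ supp (F ρ)` (pivots), and `p`
injective. [folklore] -/
theorem stub_echelonPivots : ∀ (N : ℕ) (g : Fin N → MvPolynomial (Fin 2) ℂ) (ω : (Fin 2 →₀ ℕ) → ℤ),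
    (∀ q ∈ (Finset.univ.biUnion fun i => (g i).support), ∀ q' ∈ (Finset.univ.biUnion fun i => (g i).support),
      ω q = ω q' → q = q') →
    ∃ (r : ℕ) (F : Fin r → MvPolynomial (Fin 2) ℂ) (a : Fin N → Fin r → ℂ) (p : Fin r → (Fin 2 →₀ ℕ)),
      r ≤ N ∧ (∀ i, g i = ∑ ρ, a i ρ • F ρ) ∧
      (∀ ρ, (F ρ).support ⊆ Finset.univ.biUnion fun i => (g i).support) ∧
      (∀ ρ, p ρ ∈ (F ρ).support ∧ ∀ q ∈ (F ρ).support, q ≠ p ρ → ω (p ρ) < ω q) ∧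
      Function.Injective p := by
  intro N g ω hω
  have hgU : ∀ i, (g i).support ⊆ Finset.univ.biUnion fun i => (g i).support := fun i =>
    Finset.subset_biUnion_of_mem (fun i => (g i).support) (Finset.mem_univ i)
  obtain ⟨r, F, p, hrN, hspan, hFU, hp, hinj⟩ := exists_echelon _ ω hω N g hgU
  choose a ha using fun i => (Submodule.mem_span_range_iff_exists_fun ℂ).1 (hspan i)
  exact ⟨r, F, a, p, hrN, fun i => (ha i).symm, hFU, hp, hinj⟩

end Summit.ValiantsHypothesis.ValiantsHypothesis.Theorems.TwoProducts.EchelonPivots
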